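import Summits.CriticalPhenomena.PercolationContinuityZ3.Theorems.PercNearOneGluingNoHeavyLowerTailSahiGridPatternFaces

/-!
# `NoHeavyLowerTail` (crux stmt-CriticalPhenomena-4575), Sahi programme: **THE MEET FACE OF `PatternPos`, EVERY DIMENSION** —
# `sStarD A B C ≥ sStarD A B univ ≥ 0` whenever `C ⊇ A ∩ B`

Support file (seat `prim-ineq-gen-4`, generation 12; `--supports stmt-CriticalPhenomena-4575`).  Pure proofs, no definitions, no `sorry`,
standard axioms.  Vocabulary of `…SahiGridPattern{,YProfile,ZDecomp,Faces}`.

THE MATHEMATICS.  By the `y`-decomposition `sStarD A B C = Σ_{y ∈ C} P_y(A,B)` (`sStarD_eq_sum_yProfile`) and the sign structure of the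
`y`-profile (`P_y(A,B) ≤ 0` off `A ∩ B`, `yProfile_nonpos_of_not_mem`), the pattern functional is ANTITONE in the third set outside the
meet of the first two: if `C ⊆ C'` and `C' ∖ C` misses `A ∩ B` then `sStarD A B C' ≤ sStarD A B C` (`sStarD_anti_off_meet`).  Taking
`C' = univ`: for up-sets `A, B` and ANY finset `C ⊇ A ∩ B`,
  `0 ≤ sStarD A B univ ≤ sStarD A B C`   (`sStarD_univ_le_of_inter_subset`, `sStarD_nonneg_of_inter_subset`, and the slot-permuted forms),
a face of `PatternPos d` in every dimension `d`; since `A ∩ B ⊆ A`, it gives the **NESTED-PAIR FACE**: `sStarD A B C ≥ 0` whenever two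
of the three up-sets are nested (`sStarD_nonneg_of_subset₁₃` and its five slot-permuted forms) — containing the faces "one set is the whole
cube" (`sStarD_univ_nonneg`, `…_of_eq_univ₁₂`), "one set below the other two" (`…_of_subset_inter`), "one set above the other two", and the
whole family of COEFFICIENTWISE ZEROS of generation 6/11
(`A, B` on disjoint coordinate blocks, `C ⊇ A ∪ B`), around which the `m = 5` violators of factor-2 top-slice dominance live (ttrl l.1110,
memo `run/shared/lean/prim/prim-ineq-gen-4/FINDING-STEP-TRANSFER-g12.md`).  Measure-level shadow: `E₃(A,B,C) ≥ Cov(A,B)` for `C ⊇ A∩B`.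
[this work]
-/

namespace Summit.CriticalPhenomena.PercolationContinuityZ3.Theorems.SahiGridPattern

open Finset SahiGrid3
open scoped BigOperators

variable {d : ℕ}

/-- **Antitonicity off the meet** (every dimension): enlarging the third set by points outside `A ∩ B` can only decrease `sStarD`. [this work] -/
theorem sStarD_anti_off_meet {A B C C' : Finset (Pd d)} (hA : IsUpperSet (A : Set (Pd d))) (hB : IsUpperSet (B : Set (Pd d)))
    (hCC' : C ⊆ C') (h : ∀ y ∈ C', y ∉ C → y ∉ A ∩ B) : sStarD A B C' ≤ sStarD A B C := by
  rw [sStarD_eq_sum_yProfile, sStarD_eq_sum_yProfile, ← Finset.sum_sdiff hCC']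
  have hneg : (∑ y ∈ C' \ C, yProfile A B y) ≤ 0 :=
    Finset.sum_nonpos fun y hy => by
      rw [Finset.mem_sdiff] at hy
      exact yProfile_nonpos_of_not_mem hA hB (h y hy.1 hy.2)
  linarith

/-- **The meet face, comparison form** (every dimension): for up-sets `A, B` and any `C ⊇ A ∩ B`, `sStarD A B univ ≤ sStarD A B C`.
[this work] -/
theorem sStarD_univ_le_of_inter_subset {A B C : Finset (Pd d)} (hA : IsUpperSet (A : Set (Pd d))) (hB : IsUpperSet (B : Set (Pd d)))
    (h : A ∩ B ⊆ C) : sStarD A B univ ≤ sStarD A B C :=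
  sStarD_anti_off_meet hA hB (Finset.subset_univ C) fun _ _ hyC hyAB => hyC (h hyAB)

/-- **THE MEET FACE OF `PatternPos`** (every dimension): for up-sets `A, B ⊆ [3]^d` and any finset `C ⊇ A ∩ B`, `0 ≤ sStarD A B C`.
[this work] -/
theorem sStarD_nonneg_of_inter_subset {A B C : Finset (Pd d)} (hA : IsUpperSet (A : Set (Pd d))) (hB : IsUpperSet (B : Set (Pd d)))
    (h : A ∩ B ⊆ C) : 0 ≤ sStarD A B C :=
  le_trans (sStarD_univ_nonneg hA hB) (sStarD_univ_le_of_inter_subset hA hB h)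

/-- Meet face, first slot: `B ∩ C ⊆ A ⟹ 0 ≤ sStarD A B C` for up-sets `B, C`. [this work] -/
theorem sStarD_nonneg_of_inter_subset₁ {A B C : Finset (Pd d)} (hB : IsUpperSet (B : Set (Pd d))) (hC : IsUpperSet (C : Set (Pd d)))
    (h : B ∩ C ⊆ A) : 0 ≤ sStarD A B C := by
  rw [sStarD_swap12, sStarD_swap23]
  exact sStarD_nonneg_of_inter_subset hB hC h

/-- Meet face, second slot: `A ∩ C ⊆ B ⟹ 0 ≤ sStarD A B C` for up-sets `A, C`. [this work] -/
theorem sStarD_nonneg_of_inter_subset₂ {A B C : Finset (Pd d)} (hA : IsUpperSet (A : Set (Pd d))) (hC : IsUpperSet (C : Set (Pd d)))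
    (h : A ∩ C ⊆ B) : 0 ≤ sStarD A B C := by
  rw [sStarD_swap23]
  exact sStarD_nonneg_of_inter_subset hA hC h

/-- **NESTED-PAIR FACE** (every dimension): if `A ⊆ C` then `0 ≤ sStarD A B C` for up-sets `A, B` and ANY `B`-companion — the
Latin-model (coefficientwise) form of the nested-pair case of Sahi's `C₃`; it contains "one set above the other two" and every
coefficientwise zero `(A ⊥ B, C ⊇ A ∪ B)`. [this work] -/
theorem sStarD_nonneg_of_subset₁₃ {A B C : Finset (Pd d)} (hA : IsUpperSet (A : Set (Pd d))) (hB : IsUpperSet (B : Set (Pd d)))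
    (hAC : A ⊆ C) : 0 ≤ sStarD A B C :=
  sStarD_nonneg_of_inter_subset hA hB (fun _ hy => hAC (Finset.mem_inter.1 hy).1)

/-- Nested-pair face, `B ⊆ C`. [this work] -/
theorem sStarD_nonneg_of_subset₂₃ {A B C : Finset (Pd d)} (hA : IsUpperSet (A : Set (Pd d))) (hB : IsUpperSet (B : Set (Pd d)))
    (hBC : B ⊆ C) : 0 ≤ sStarD A B C :=
  sStarD_nonneg_of_inter_subset hA hB (fun _ hy => hBC (Finset.mem_inter.1 hy).2)

/-- Nested-pair face, `A ⊆ B`. [this work] -/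
theorem sStarD_nonneg_of_subset₁₂ {A B C : Finset (Pd d)} (hA : IsUpperSet (A : Set (Pd d))) (hC : IsUpperSet (C : Set (Pd d)))
    (hAB : A ⊆ B) : 0 ≤ sStarD A B C := by
  rw [sStarD_swap23]; exact sStarD_nonneg_of_subset₁₃ hA hC hAB

/-- Nested-pair face, `C ⊆ B`. [this work] -/
theorem sStarD_nonneg_of_subset₃₂ {A B C : Finset (Pd d)} (hA : IsUpperSet (A : Set (Pd d))) (hC : IsUpperSet (C : Set (Pd d)))
    (hCB : C ⊆ B) : 0 ≤ sStarD A B C := by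
  rw [sStarD_swap23]; exact sStarD_nonneg_of_subset₂₃ hA hC hCB

/-- Nested-pair face, `B ⊆ A`. [this work] -/
theorem sStarD_nonneg_of_subset₂₁ {A B C : Finset (Pd d)} (hB : IsUpperSet (B : Set (Pd d))) (hC : IsUpperSet (C : Set (Pd d)))
    (hBA : B ⊆ A) : 0 ≤ sStarD A B C := by
  rw [sStarD_swap12, sStarD_swap23]; exact sStarD_nonneg_of_subset₁₃ hB hC hBA

/-- Nested-pair face, `C ⊆ A`. [this work] -/
theorem sStarD_nonneg_of_subset₃₁ {A B C : Finset (Pd d)} (hB : IsUpperSet (B : Set (Pd d))) (hC : IsUpperSet (C : Set (Pd d)))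
    (hCA : C ⊆ A) : 0 ≤ sStarD A B C := by
  rw [sStarD_swap12, sStarD_swap23]; exact sStarD_nonneg_of_subset₂₃ hB hC hCA

end Summit.CriticalPhenomena.PercolationContinuityZ3.Theorems.SahiGridPattern
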